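import Mathlib.Topology.MetricSpace.Basic
import Mathlib.Algebra.Order.BigOperators.Group.Finset
import Mathlib.Analysis.InnerProductSpace.PiL2

/-!
# Crux `ChessboardParticlePlanes.LjPlaneChessboard` (stmt-AtomisticToContinuum-6709), line `Sketch` —
# partner-load accounting (the combinatorial half of the hard-core certificate)

The analytic core of the crux (`stub_deficitCore`) is to be closed by a radial CERTIFICATE `h`
supported in the hard-core disk `B(2/3)`: the cross-plane Lennard-Jones kernel minus `h` is positive
definite, and the quadratic form of `h` itself on a signed difference `1_σ − 1_σ'` of two
`2/3`-separated layers is non-negative for purely COMBINATORIAL reasons.  This file proves that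
combinatorial half in the generality of a metric space `X` and a profile `Ψ : ℝ → ℝ` of the distance
satisfying the packing proxy

* `Ψ d ≤ Ψ 0` for `d < 1/3`, `Ψ d ≤ 0` for `1/3 ≤ d`, `0 ≤ Ψ 0` (and `Ψ d = 0` for `2/3 ≤ d` in the
  two-colour statement):

* `sep_filter_dist_lt_card_le_one` — a `2/3`-separated finite set has at most one point at distance
  `< 1/3` from any given point (two such points would be `< 2/3` apart);
* `partnerLoad_le` — hence the Ψ-load `∑_{y ∈ Y} Ψ(dist x y)` of any `2/3`-separated finite `Y` at any
  point `x` is at most `Ψ 0`;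
* `twoColour_sum_nonneg` — for two `2/3`-separated finite sets `S`, `T` ("colours"), the signed form
  `Σ_{S×S} Ψ + Σ_{T×T} Ψ − Σ_{S×T} Ψ − Σ_{T×S} Ψ ≥ 0`: same-colour pairs only meet the diagonal
  (`|S| Ψ(0) + |T| Ψ(0)`), and each cross sum is a sum of partner loads, `≤ |S| Ψ(0)` resp. `≤ |T| Ψ(0)`.

[folklore; the "partner accounting" of the crux idea card `mismatch-field-certificate`, in the proxy
form where at most one partner can carry positive load]
-/

namespace Summit.AtomisticToContinuum.Crystallization.Theorems.ChessboardParticlePlanesLjPlaneChessboard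

open Finset

variable {X : Type*} [MetricSpace X]

/-- In a `2/3`-separated finite set at most one point lies at distance `< 1/3` from a given point:
two such points would be at distance `< 2/3` by the triangle inequality. [folklore] -/
theorem sep_filter_dist_lt_card_le_one (Y : Finset X) (x : X)
    (hsep : ∀ y ∈ Y, ∀ y' ∈ Y, y ≠ y' → (2 : ℝ) / 3 ≤ dist y y') :
    (Y.filter fun y => dist x y < 1 / 3).card ≤ 1 := by
  classical
  rw [Finset.card_le_one]
  intro y hy y' hy'
  rw [Finset.mem_filter] at hy hy'
  by_contra hne
  have h := hsep y hy.1 y' hy'.1 hne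
  have htri : dist y y' ≤ dist y x + dist x y' := dist_triangle y x y'
  rw [dist_comm y x] at htri
  linarith [hy.2, hy'.2]

/-- **Partner load.**  If `0 ≤ Ψ 0`, `Ψ d ≤ Ψ 0` for `d < 1/3` and `Ψ d ≤ 0` for `1/3 ≤ d`, then for
every `2/3`-separated finite set `Y` and every point `x`, `∑_{y ∈ Y} Ψ(dist x y) ≤ Ψ 0`: the points
at distance `≥ 1/3` contribute `≤ 0`, and at most one point is closer. [folklore] -/
theorem partnerLoad_le (Ψ : ℝ → ℝ) (hΨ0 : 0 ≤ Ψ 0) (hin : ∀ d, d < 1 / 3 → Ψ d ≤ Ψ 0)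
    (hout : ∀ d, 1 / 3 ≤ d → Ψ d ≤ 0) (Y : Finset X) (x : X)
    (hsep : ∀ y ∈ Y, ∀ y' ∈ Y, y ≠ y' → (2 : ℝ) / 3 ≤ dist y y') :
    ∑ y ∈ Y, Ψ (dist x y) ≤ Ψ 0 := by
  classical
  set N := Y.filter fun y => dist x y < 1 / 3 with hN
  have hsplit := Finset.sum_filter_add_sum_filter_not Y (fun y => dist x y < 1 / 3)
    (fun y => Ψ (dist x y))
  rw [← hsplit]
  have hfar : ∑ y ∈ Y.filter (fun y => ¬ dist x y < 1 / 3), Ψ (dist x y) ≤ 0 := by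
    refine Finset.sum_nonpos fun y hy => ?_
    rw [Finset.mem_filter] at hy
    exact hout _ (not_lt.1 hy.2)
  have hnear : ∑ y ∈ N, Ψ (dist x y) ≤ Ψ 0 := by
    have hcard : N.card ≤ 1 := sep_filter_dist_lt_card_le_one Y x hsep
    rcases Nat.le_one_iff_eq_zero_or_eq_one.1 hcard with h0 | h1
    · rw [Finset.card_eq_zero.1 h0, Finset.sum_empty]
      exact hΨ0
    · obtain ⟨y, hy⟩ := Finset.card_eq_one.1 h1
      rw [hy, Finset.sum_singleton]
      have hyN : y ∈ N := by rw [hy]; exact Finset.mem_singleton_self y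
      rw [hN, Finset.mem_filter] at hyN
      exact hin _ hyN.2
  rw [← hN]
  linarith

/-- Same-colour sums see only the diagonal: if `Ψ d = 0` for `2/3 ≤ d` and `S` is `2/3`-separated,
then `∑_{x ∈ S} ∑_{y ∈ S} Ψ(dist x y) = |S| · Ψ 0`. [folklore] -/
theorem sameColour_sum_eq (Ψ : ℝ → ℝ) (hsupp : ∀ d, (2 : ℝ) / 3 ≤ d → Ψ d = 0) (S : Finset X)
    (hS : ∀ y ∈ S, ∀ y' ∈ S, y ≠ y' → (2 : ℝ) / 3 ≤ dist y y') :
    ∑ x ∈ S, ∑ y ∈ S, Ψ (dist x y) = S.card * Ψ 0 := by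
  classical
  have hrow : ∀ x ∈ S, ∑ y ∈ S, Ψ (dist x y) = Ψ 0 := by
    intro x hx
    rw [Finset.sum_eq_single_of_mem x hx]
    · rw [dist_self]
    · intro y hy hyx
      exact hsupp _ (hS x hx y hy (Ne.symm hyx))
  rw [Finset.sum_congr rfl hrow, Finset.sum_const, nsmul_eq_mul]

/-- **Two-colour partner accounting.**  Let `Ψ : ℝ → ℝ` satisfy `0 ≤ Ψ 0`, `Ψ d ≤ Ψ 0` for
`d < 1/3`, `Ψ d ≤ 0` for `1/3 ≤ d` and `Ψ d = 0` for `2/3 ≤ d`.  Then for any two `2/3`-separated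
finite sets `S`, `T` of a metric space the signed two-colour form is non-negative:
`0 ≤ Σ_{S×S} Ψ + Σ_{T×T} Ψ − Σ_{S×T} Ψ − Σ_{T×S} Ψ`
(same-colour sums are `|S| Ψ 0`, `|T| Ψ 0`; each cross sum is a sum of partner loads, bounded by
`partnerLoad_le`).  This is the real-space half of the hard-core certificate for the two-layer offset
inequality of the crux. [folklore] -/
theorem twoColour_sum_nonneg (Ψ : ℝ → ℝ) (hΨ0 : 0 ≤ Ψ 0) (hin : ∀ d, d < 1 / 3 → Ψ d ≤ Ψ 0)
    (hout : ∀ d, 1 / 3 ≤ d → Ψ d ≤ 0) (hsupp : ∀ d, (2 : ℝ) / 3 ≤ d → Ψ d = 0) (S T : Finset X)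
    (hS : ∀ y ∈ S, ∀ y' ∈ S, y ≠ y' → (2 : ℝ) / 3 ≤ dist y y')
    (hT : ∀ y ∈ T, ∀ y' ∈ T, y ≠ y' → (2 : ℝ) / 3 ≤ dist y y') :
    0 ≤ (∑ x ∈ S, ∑ y ∈ S, Ψ (dist x y)) + (∑ x ∈ T, ∑ y ∈ T, Ψ (dist x y))
        - (∑ x ∈ S, ∑ y ∈ T, Ψ (dist x y)) - (∑ x ∈ T, ∑ y ∈ S, Ψ (dist x y)) := by
  rw [sameColour_sum_eq Ψ hsupp S hS, sameColour_sum_eq Ψ hsupp T hT]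
  have hST : ∑ x ∈ S, ∑ y ∈ T, Ψ (dist x y) ≤ S.card * Ψ 0 := by
    calc ∑ x ∈ S, ∑ y ∈ T, Ψ (dist x y) ≤ ∑ _x ∈ S, Ψ 0 :=
          Finset.sum_le_sum fun x _ => partnerLoad_le Ψ hΨ0 hin hout T x hT
      _ = S.card * Ψ 0 := by rw [Finset.sum_const, nsmul_eq_mul]
  have hTS : ∑ x ∈ T, ∑ y ∈ S, Ψ (dist x y) ≤ T.card * Ψ 0 := by
    calc ∑ x ∈ T, ∑ y ∈ S, Ψ (dist x y) ≤ ∑ _x ∈ T, Ψ 0 :=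
          Finset.sum_le_sum fun x _ => partnerLoad_le Ψ hΨ0 hin hout S x hS
      _ = T.card * Ψ 0 := by rw [Finset.sum_const, nsmul_eq_mul]
  linarith

/-- **Partner accounting in the plane (registered sub-goal of `stub_deficitCore`).**  For a profile
`Ψ` with `0 ≤ Ψ 0`, `Ψ d ≤ Ψ 0` (`d < 1/3`), `Ψ d ≤ 0` (`1/3 ≤ d`), `Ψ d = 0` (`2/3 ≤ d`) and two
`2/3`-separated finite planar sets `S`, `T`:
`0 ≤ Σ_{S×S} Ψ(dist) + Σ_{T×T} Ψ(dist) − Σ_{S×T} Ψ(dist) − Σ_{T×S} Ψ(dist)`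
(`twoColour_sum_nonneg` in `EuclideanSpace ℝ (Fin 2)`). [folklore] -/
theorem partnerAccounting :
    ∀ (Ψ : ℝ → ℝ), 0 ≤ Ψ 0 → (∀ d : ℝ, d < 1 / 3 → Ψ d ≤ Ψ 0) → (∀ d : ℝ, 1 / 3 ≤ d → Ψ d ≤ 0) →
      (∀ d : ℝ, (2 : ℝ) / 3 ≤ d → Ψ d = 0) → ∀ (S T : Finset (EuclideanSpace ℝ (Fin 2))),
      (∀ y ∈ S, ∀ y' ∈ S, y ≠ y' → (2 : ℝ) / 3 ≤ dist y y') →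
      (∀ y ∈ T, ∀ y' ∈ T, y ≠ y' → (2 : ℝ) / 3 ≤ dist y y') →
      0 ≤ (∑ x ∈ S, ∑ y ∈ S, Ψ (dist x y)) + (∑ x ∈ T, ∑ y ∈ T, Ψ (dist x y))
          - (∑ x ∈ S, ∑ y ∈ T, Ψ (dist x y)) - (∑ x ∈ T, ∑ y ∈ S, Ψ (dist x y)) :=
  fun Ψ h0 hin hout hsupp S T hS hT => twoColour_sum_nonneg Ψ h0 hin hout hsupp S T hS hT

section InnerProduct

variable {E : Type*} [NormedAddCommGroup E] [InnerProductSpace ℝ E]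

/-- **Three points in a small disk.**  In a real inner-product space, among three points within
distance `r` of a centre `x` some two are at distance `≤ √3 · r`:
`Σ_{i<j} ‖yᵢ − yⱼ‖² = 3 Σᵢ ‖yᵢ − x‖² − ‖Σᵢ (yᵢ − x)‖² ≤ 9 r²`.  Consequently a `d`-separated set
has at most two points in any open disk of radius `< d/√3` (used with `d = 2/3`, radius
`2/(3√3) ≈ 0.385`, for the refined packing proxy). [folklore] -/
theorem exists_pair_dist_sq_le_of_three (x y₁ y₂ y₃ : E) (r : ℝ)
    (h₁ : dist y₁ x ≤ r) (h₂ : dist y₂ x ≤ r) (h₃ : dist y₃ x ≤ r) :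
    dist y₁ y₂ ^ 2 ≤ 3 * r ^ 2 ∨ dist y₁ y₃ ^ 2 ≤ 3 * r ^ 2 ∨ dist y₂ y₃ ^ 2 ≤ 3 * r ^ 2 := by
  have hr : 0 ≤ r := le_trans dist_nonneg h₁
  set a := y₁ - x with ha
  set b := y₂ - x with hb
  set c := y₃ - x with hc
  have e12 : dist y₁ y₂ = ‖a - b‖ := by rw [dist_eq_norm, ha, hb, sub_sub_sub_cancel_right]
  have e13 : dist y₁ y₃ = ‖a - c‖ := by rw [dist_eq_norm, ha, hc, sub_sub_sub_cancel_right]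
  have e23 : dist y₂ y₃ = ‖b - c‖ := by rw [dist_eq_norm, hb, hc, sub_sub_sub_cancel_right]
  have na : ‖a‖ ≤ r := by rwa [ha, ← dist_eq_norm]
  have nb : ‖b‖ ≤ r := by rwa [hb, ← dist_eq_norm]
  have nc : ‖c‖ ≤ r := by rwa [hc, ← dist_eq_norm]
  -- the parallelogram-type identity
  have key : ‖a - b‖ ^ 2 + ‖a - c‖ ^ 2 + ‖b - c‖ ^ 2
      = 3 * (‖a‖ ^ 2 + ‖b‖ ^ 2 + ‖c‖ ^ 2) - ‖a + b + c‖ ^ 2 := by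
    simp only [@norm_sub_sq_real, @norm_add_sq_real, inner_add_left]
    ring
  have hsum : ‖a - b‖ ^ 2 + ‖a - c‖ ^ 2 + ‖b - c‖ ^ 2 ≤ 9 * r ^ 2 := by
    rw [key]
    have h2a : ‖a‖ ^ 2 ≤ r ^ 2 := pow_le_pow_left₀ (norm_nonneg _) na 2
    have h2b : ‖b‖ ^ 2 ≤ r ^ 2 := pow_le_pow_left₀ (norm_nonneg _) nb 2
    have h2c : ‖c‖ ^ 2 ≤ r ^ 2 := pow_le_pow_left₀ (norm_nonneg _) nc 2
    nlinarith [sq_nonneg ‖a + b + c‖]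
  rw [e12, e13, e23]
  by_contra hcon
  simp only [not_or, not_le] at hcon
  obtain ⟨k1, k2, k3⟩ := hcon
  linarith

end InnerProduct

section Weighted

variable {Y : Type*} [MetricSpace Y]

/-- A cross sum of partner loads is at most `min(|S|, |T|) · Ψ 0`: summing the loads over `S` gives
`≤ |S| Ψ 0`, and by `Finset.sum_comm` + symmetry of `dist` the same sum is a sum of loads over `T`,
`≤ |T| Ψ 0`. [folklore] -/
theorem crossSum_le_min_card_mul (Ψ : ℝ → ℝ) (hΨ0 : 0 ≤ Ψ 0) (hin : ∀ d, d < 1 / 3 → Ψ d ≤ Ψ 0)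
    (hout : ∀ d, 1 / 3 ≤ d → Ψ d ≤ 0) (S T : Finset Y)
    (hS : ∀ y ∈ S, ∀ y' ∈ S, y ≠ y' → (2 : ℝ) / 3 ≤ dist y y')
    (hT : ∀ y ∈ T, ∀ y' ∈ T, y ≠ y' → (2 : ℝ) / 3 ≤ dist y y') :
    ∑ x ∈ S, ∑ y ∈ T, Ψ (dist x y) ≤ min (S.card : ℝ) (T.card : ℝ) * Ψ 0 := by
  have h1 : ∑ x ∈ S, ∑ y ∈ T, Ψ (dist x y) ≤ (S.card : ℝ) * Ψ 0 := by
    calc ∑ x ∈ S, ∑ y ∈ T, Ψ (dist x y) ≤ ∑ _x ∈ S, Ψ 0 :=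
          Finset.sum_le_sum fun x _ => partnerLoad_le Ψ hΨ0 hin hout T x hT
      _ = (S.card : ℝ) * Ψ 0 := by rw [Finset.sum_const, nsmul_eq_mul]
  have h2 : ∑ x ∈ S, ∑ y ∈ T, Ψ (dist x y) ≤ (T.card : ℝ) * Ψ 0 := by
    rw [Finset.sum_comm]
    calc ∑ y ∈ T, ∑ x ∈ S, Ψ (dist x y) = ∑ y ∈ T, ∑ x ∈ S, Ψ (dist y x) := by
          simp_rw [dist_comm]
      _ ≤ ∑ _y ∈ T, Ψ 0 := Finset.sum_le_sum fun y _ => partnerLoad_le Ψ hΨ0 hin hout S y hS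
      _ = (T.card : ℝ) * Ψ 0 := by rw [Finset.sum_const, nsmul_eq_mul]
  rcases le_total (S.card : ℝ) (T.card : ℝ) with h | h
  · rw [min_eq_left h]; exact h1
  · rw [min_eq_right h]; exact h2

/-- **Weighted two-colour partner accounting.**  Under the packing proxy of `twoColour_sum_nonneg`
and for weights `α, β ≥ 0`, the asymmetric signed form is still non-negative:
`0 ≤ α² Σ_{S×S} Ψ + β² Σ_{T×T} Ψ − αβ (Σ_{S×T} Ψ + Σ_{T×S} Ψ)`.
Indeed the same-colour sums are `|S| Ψ0`, `|T| Ψ0`, each cross sum is `≤ m Ψ0` with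
`m = min(|S|,|T|)`, and `α²|S| + β²|T| − 2αβ m ≥ m (α − β)² ≥ 0`.  (Needed for second-neighbour
layer pairs with UNEQUAL gaps `c ≠ c'`, whose certificate block is `h · (α, −β)ᵀ(α, −β)`.)
[folklore] -/
theorem twoColour_weighted_sum_nonneg (Ψ : ℝ → ℝ) (hΨ0 : 0 ≤ Ψ 0)
    (hin : ∀ d, d < 1 / 3 → Ψ d ≤ Ψ 0) (hout : ∀ d, 1 / 3 ≤ d → Ψ d ≤ 0)
    (hsupp : ∀ d, (2 : ℝ) / 3 ≤ d → Ψ d = 0) (α β : ℝ) (hα : 0 ≤ α) (hβ : 0 ≤ β) (S T : Finset Y)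
    (hS : ∀ y ∈ S, ∀ y' ∈ S, y ≠ y' → (2 : ℝ) / 3 ≤ dist y y')
    (hT : ∀ y ∈ T, ∀ y' ∈ T, y ≠ y' → (2 : ℝ) / 3 ≤ dist y y') :
    0 ≤ α ^ 2 * (∑ x ∈ S, ∑ y ∈ S, Ψ (dist x y)) + β ^ 2 * (∑ x ∈ T, ∑ y ∈ T, Ψ (dist x y))
        - α * β * ((∑ x ∈ S, ∑ y ∈ T, Ψ (dist x y)) + (∑ x ∈ T, ∑ y ∈ S, Ψ (dist x y))) := by
  rw [sameColour_sum_eq Ψ hsupp S hS, sameColour_sum_eq Ψ hsupp T hT]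
  have hST := crossSum_le_min_card_mul Ψ hΨ0 hin hout S T hS hT
  have hTS := crossSum_le_min_card_mul Ψ hΨ0 hin hout T S hT hS
  rw [min_comm] at hTS
  set m := min (S.card : ℝ) (T.card : ℝ) with hm
  have hmS : m ≤ (S.card : ℝ) := min_le_left _ _
  have hmT : m ≤ (T.card : ℝ) := min_le_right _ _
  have hm0 : 0 ≤ m := le_min (Nat.cast_nonneg _) (Nat.cast_nonneg _)
  have hab : 0 ≤ α * β := mul_nonneg hα hβ
  have hcross : α * β * ((∑ x ∈ S, ∑ y ∈ T, Ψ (dist x y)) + (∑ x ∈ T, ∑ y ∈ S, Ψ (dist x y)))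
      ≤ α * β * (2 * (m * Ψ 0)) := mul_le_mul_of_nonneg_left (by linarith) hab
  have hkey : α * β * (2 * (m * Ψ 0)) ≤ α ^ 2 * ((S.card : ℝ) * Ψ 0) + β ^ 2 * ((T.card : ℝ) * Ψ 0) := by
    have e1 : α ^ 2 * (m * Ψ 0) ≤ α ^ 2 * ((S.card : ℝ) * Ψ 0) :=
      mul_le_mul_of_nonneg_left (mul_le_mul_of_nonneg_right hmS hΨ0) (sq_nonneg α)
    have e2 : β ^ 2 * (m * Ψ 0) ≤ β ^ 2 * ((T.card : ℝ) * Ψ 0) :=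
      mul_le_mul_of_nonneg_left (mul_le_mul_of_nonneg_right hmT hΨ0) (sq_nonneg β)
    have e3 : 0 ≤ (α - β) ^ 2 * (m * Ψ 0) := mul_nonneg (sq_nonneg _) (mul_nonneg hm0 hΨ0)
    nlinarith
  linarith

/-- **Weighted partner accounting in the plane (registered sub-goal of `stub_deficitCore`).**
`twoColour_weighted_sum_nonneg` in `EuclideanSpace ℝ (Fin 2)`. [folklore] -/
theorem partnerAccountingWeighted :
    ∀ (Ψ : ℝ → ℝ), 0 ≤ Ψ 0 → (∀ d : ℝ, d < 1 / 3 → Ψ d ≤ Ψ 0) → (∀ d : ℝ, 1 / 3 ≤ d → Ψ d ≤ 0) →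
      (∀ d : ℝ, (2 : ℝ) / 3 ≤ d → Ψ d = 0) → ∀ (α β : ℝ), 0 ≤ α → 0 ≤ β →
      ∀ (S T : Finset (EuclideanSpace ℝ (Fin 2))),
      (∀ y ∈ S, ∀ y' ∈ S, y ≠ y' → (2 : ℝ) / 3 ≤ dist y y') →
      (∀ y ∈ T, ∀ y' ∈ T, y ≠ y' → (2 : ℝ) / 3 ≤ dist y y') →
      0 ≤ α ^ 2 * (∑ x ∈ S, ∑ y ∈ S, Ψ (dist x y)) + β ^ 2 * (∑ x ∈ T, ∑ y ∈ T, Ψ (dist x y))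
          - α * β * ((∑ x ∈ S, ∑ y ∈ T, Ψ (dist x y)) + (∑ x ∈ T, ∑ y ∈ S, Ψ (dist x y))) :=
  fun Ψ h0 hin hout hsupp α β hα hβ S T hS hT =>
    twoColour_weighted_sum_nonneg Ψ h0 hin hout hsupp α β hα hβ S T hS hT

end Weighted

end Summit.AtomisticToContinuum.Crystallization.Theorems.ChessboardParticlePlanesLjPlaneChessboard
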